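import Literature.NumberTheory.Sieve.SmoothExpSumCrude
import Literature.NumberTheory.LFunctions.HuxleyLargeValues
import HarnessLib

/-!
# Large values of exponential sums over smooth numbers, I: the duality step (Harper's Prop. 3, first half)

Topic `Literature/NumberTheory/Sieve`; a PROVED file toward
`Literature.NumberTheory.DiophantineGeometry.XYZUpperHalf` ([Harper2016, Cor. 1]). This is the
first half of the proof of Proposition 3 of op. cit. (§4): the Bourgain/Halász–Montgomery duality
(Cauchy–Schwarz over `n`), followed by the canonical factorisation `n = m n'` (at the threshold `W`),
dropping the arithmetic conditions on `n'`, expanding the square and summing the geometric series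
over `n'`:

`largeValues_duality` — for `1 ≤ W ≤ A ≤ x`, points `θ_r` (`r ∈ T`) and coefficients `|a_n| ≤ 1`,
`(∑_r |∑_{n ≤ x, n ∈ S(y)} a_n e(nθ_r)|)² ≤ Ψ(x,y) · ((#T)² Ψ(A,y) + ∑_{m ∈ 𝓜} ∑_{r,s} min(x/m, 1/(2‖m(θ_r − θ_s)‖)))`
(printed: `δ²R²Ψ(x,y)² ≤ … ≤ Ψ(x,y) ∑_n |∑_r c_r e(nθ_r)|²` and the display following it, with
`W = x/yK`, `A = δ³x`). The phases come from `exists_norm_le_one_mul_eq_norm`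
(HuxleyLargeValues); the complex Cauchy–Schwarz helper is private.

## References

* A. J. Harper, Compositio Math. 152 (2016) 1121–1158, §4, proof of Proposition 3 (first two
  displays) [Harper2016].
* J. Bourgain, *On Λ(p)-subsets of squares*, Israel J. Math. 67 (1989), §4.
-/

noncomputable section

open Finset Real
open scoped FourierTransform ComplexConjugate
open Literature.NumberTheory.Sieve.Vinogradov

namespace Literature.NumberTheory.Sieve

/-- Cauchy–Schwarz for complex finite sums: `|∑ u_n v_n|² ≤ (∑ |u_n|²)(∑ |v_n|²)`. [folklore] -/
private theorem norm_sum_mul_sq_le' {ι : Type*} (s : Finset ι) (u v : ι → ℂ) :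
    ‖∑ n ∈ s, u n * v n‖ ^ 2 ≤ (∑ n ∈ s, ‖u n‖ ^ 2) * (∑ n ∈ s, ‖v n‖ ^ 2) := by
  have h1 : ‖∑ n ∈ s, u n * v n‖ ≤ ∑ n ∈ s, ‖u n‖ * ‖v n‖ := by
    refine (norm_sum_le _ _).trans (Finset.sum_le_sum fun n _ => ?_)
    rw [norm_mul]
  have h2 := Finset.sum_mul_sq_le_sq_mul_sq s (fun n => ‖u n‖) (fun n => ‖v n‖)
  have h0 : 0 ≤ ∑ n ∈ s, ‖u n‖ * ‖v n‖ := Finset.sum_nonneg fun n _ => by positivity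
  calc ‖∑ n ∈ s, u n * v n‖ ^ 2 ≤ (∑ n ∈ s, ‖u n‖ * ‖v n‖) ^ 2 :=
        pow_le_pow_left₀ (norm_nonneg _) h1 2
    _ ≤ _ := h2

/-- **The duality step** (Harper §4, first half of the proof of Proposition 3). See the module
docstring. [cite: Harper2016, §4, proof of Proposition 3] -/
theorem largeValues_duality {ι : Type*} (T : Finset ι) (θ : ι → ℝ) {x W A : ℝ} {y : ℕ}
    (hW1 : 1 ≤ W) (hWA : W ≤ A) (hAx : A ≤ x) (a : ℕ → ℂ) (ha : ∀ n, ‖a n‖ ≤ 1) :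
    (∑ r ∈ T, ‖∑ n ∈ Nat.smoothNumbersUpTo ⌊x⌋₊ (y + 1), a n * (𝐞 ((n : ℝ) * θ r) : ℂ)‖) ^ 2 ≤
      (Nat.smoothNumbersUpTo ⌊x⌋₊ (y + 1)).card *
        ((T.card : ℝ) ^ 2 * (Nat.smoothNumbersUpTo ⌊A⌋₊ (y + 1)).card +
          ∑ m ∈ prefixSet y W, ∑ r ∈ T, ∑ s ∈ T, geomBound (x / m) ((m : ℝ) * (θ r - θ s))) := by
  classical
  have hW0 : 0 < W := by linarith
  have hA0 : 0 ≤ A := by linarith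
  set S := Nat.smoothNumbersUpTo ⌊x⌋₊ (y + 1) with hS
  set F : ι → ℂ := fun r => ∑ n ∈ S, a n * (𝐞 ((n : ℝ) * θ r) : ℂ) with hF
  -- phases
  have hc : ∀ r, ∃ c : ℂ, ‖c‖ ≤ 1 ∧ c * F r = (‖F r‖ : ℂ) := fun r =>
    Literature.NumberTheory.LFunctions.exists_norm_le_one_mul_eq_norm (F r)
  choose c hc1 hc2 using hc
  set g : ℕ → ℂ := fun n => ∑ r ∈ T, c r * (𝐞 ((n : ℝ) * θ r) : ℂ) with hg
  have hgn : ∀ n, ‖g n‖ ≤ T.card := by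
    intro n
    calc ‖g n‖ ≤ ∑ r ∈ T, ‖c r * (𝐞 ((n : ℝ) * θ r) : ℂ)‖ := norm_sum_le _ _
      _ ≤ ∑ r ∈ T, (1 : ℝ) := Finset.sum_le_sum fun r _ => by
          rw [norm_mul, norm_fourierChar, mul_one]; exact hc1 r
      _ = T.card := by rw [Finset.sum_const, nsmul_eq_mul, mul_one]
  -- `∑_r |F_r| = ∑_n a_n g(n)`
  have hdual : ((∑ r ∈ T, ‖F r‖ : ℝ) : ℂ) = ∑ n ∈ S, a n * g n := by
    push_cast
    rw [Finset.sum_congr rfl fun r _ => (hc2 r).symm]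
    simp only [hF, hg, Finset.mul_sum]
    rw [Finset.sum_comm]
    refine Finset.sum_congr rfl fun n _ => Finset.sum_congr rfl fun r _ => ?_
    ring
  -- Cauchy–Schwarz over `n`
  have hCS : (∑ r ∈ T, ‖F r‖) ^ 2 ≤ S.card * ∑ n ∈ S, ‖g n‖ ^ 2 := by
    have h1 : (∑ r ∈ T, ‖F r‖) ^ 2 = ‖∑ n ∈ S, a n * g n‖ ^ 2 := by
      rw [← hdual, Complex.norm_real, Real.norm_eq_abs, abs_of_nonneg (Finset.sum_nonneg fun r _ => norm_nonneg _)]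
    rw [h1]
    refine (norm_sum_mul_sq_le' S a g).trans ?_
    apply mul_le_mul_of_nonneg_right _ (Finset.sum_nonneg fun n _ => by positivity)
    calc ∑ n ∈ S, ‖a n‖ ^ 2 ≤ ∑ n ∈ S, (1 : ℝ) := Finset.sum_le_sum fun n _ => by
          have := ha n; have h0 := norm_nonneg (a n); nlinarith
      _ = S.card := by rw [Finset.sum_const, nsmul_eq_mul, mul_one]
  refine hCS.trans (mul_le_mul_of_nonneg_left ?_ (Nat.cast_nonneg _))
  -- split `S` at `A`
  rw [hS, smoothNumbersUpTo_eq_union hAx, Finset.sum_union (by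
    rw [Finset.disjoint_left]
    intro n hn1 hn2
    rw [Nat.mem_smoothNumbersUpTo] at hn1
    rw [Finset.mem_filter, Finset.mem_Ioc] at hn2
    omega)]
  refine add_le_add ?_ ?_
  · -- `n ≤ A`: trivial bound `|g(n)| ≤ #T`
    calc ∑ n ∈ Nat.smoothNumbersUpTo ⌊A⌋₊ (y + 1), ‖g n‖ ^ 2
        ≤ ∑ n ∈ Nat.smoothNumbersUpTo ⌊A⌋₊ (y + 1), (T.card : ℝ) ^ 2 :=
          Finset.sum_le_sum fun n _ => pow_le_pow_left₀ (norm_nonneg _) (hgn n) 2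
      _ = (T.card : ℝ) ^ 2 * (Nat.smoothNumbersUpTo ⌊A⌋₊ (y + 1)).card := by
          rw [Finset.sum_const, nsmul_eq_mul]; ring
  · -- `A < n ≤ x`: factorise, drop conditions on `n'`, expand, geometric series
    rw [sum_smooth_Ioc_eq_sum_sum hW1 hWA hAx (fun n => ‖g n‖ ^ 2)]
    refine Finset.sum_le_sum fun m hm => ?_
    rw [mem_prefixSet hW0.le] at hm
    obtain ⟨hmW, -, -, -⟩ := hm
    have hm0 : (0 : ℝ) < m := by linarith
    have hm1 : 1 ≤ m := by exact_mod_cast (show (0 : ℝ) < m from hm0)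
    set N : ℕ := ⌊x / m⌋₊ with hN
    -- drop the conditions on `n'`
    have hsub : cofactorSet y A x m ⊆ Finset.Icc 1 N := by
      intro n' hn'
      rw [mem_cofactorSet (by linarith)] at hn'
      obtain ⟨h1, -, -, -, -, hle⟩ := hn'
      rw [Finset.mem_Icc]
      refine ⟨h1, Nat.le_floor ?_⟩
      rw [le_div_iff₀ hm0]; linarith
    calc ∑ n' ∈ cofactorSet y A x m, ‖g (m * n')‖ ^ 2 ≤ ∑ n' ∈ Finset.Icc 1 N, ‖g (m * n')‖ ^ 2 :=
          Finset.sum_le_sum_of_subset_of_nonneg hsub (fun _ _ _ => by positivity)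
      _ ≤ ∑ r ∈ T, ∑ s ∈ T, geomBound (x / m) ((m : ℝ) * (θ r - θ s)) := ?_
    -- expand the squares
    have hexp : ∀ n' : ℕ, ((‖g (m * n')‖ ^ 2 : ℝ) : ℂ) =
        ∑ r ∈ T, ∑ s ∈ T, c r * conj (c s) * (𝐞 ((n' : ℝ) * ((m : ℝ) * (θ r - θ s))) : ℂ) := by
      intro n'
      simp only [hg]
      rw [normSq_sum_eq_sum_sum]
      refine Finset.sum_congr rfl fun r _ => Finset.sum_congr rfl fun s _ => ?_
      rw [map_mul (starRingEnd ℂ) (c s), ← Circle.coe_inv_eq_conj, ← AddChar.map_neg_eq_inv]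
      have : (𝐞 (((m * n' : ℕ) : ℝ) * θ r) : ℂ) * (𝐞 (-(((m * n' : ℕ) : ℝ) * θ s)) : ℂ) =
          (𝐞 ((n' : ℝ) * ((m : ℝ) * (θ r - θ s))) : ℂ) := by
        rw [← Circle.coe_mul, ← AddChar.map_add_eq_mul]
        congr 2; push_cast; ring
      calc c r * (𝐞 (((m * n' : ℕ) : ℝ) * θ r) : ℂ) * (conj (c s) * (𝐞 (-(((m * n' : ℕ) : ℝ) * θ s)) : ℂ))
          = c r * conj (c s) * ((𝐞 (((m * n' : ℕ) : ℝ) * θ r) : ℂ) * (𝐞 (-(((m * n' : ℕ) : ℝ) * θ s)) : ℂ)) := by ring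
        _ = _ := by rw [this]
    have hreal : ∑ n' ∈ Finset.Icc 1 N, ‖g (m * n')‖ ^ 2 =
        ‖((∑ n' ∈ Finset.Icc 1 N, ‖g (m * n')‖ ^ 2 : ℝ) : ℂ)‖ := by
      rw [Complex.norm_real, Real.norm_eq_abs, abs_of_nonneg (Finset.sum_nonneg fun _ _ => by positivity)]
    rw [hreal, Complex.ofReal_sum, Finset.sum_congr rfl fun n' _ => hexp n', Finset.sum_comm]
    refine (norm_sum_le _ _).trans (Finset.sum_le_sum fun r _ => ?_)
    rw [Finset.sum_comm]
    refine (norm_sum_le _ _).trans (Finset.sum_le_sum fun s _ => ?_)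
    rw [← Finset.mul_sum, norm_mul]
    have hcc : ‖c r * conj (c s)‖ ≤ 1 := by
      rw [norm_mul, Complex.norm_conj]
      have := hc1 r; have := hc1 s
      have h0 := norm_nonneg (c r); have h0' := norm_nonneg (c s)
      nlinarith
    have hgeom : ‖∑ n' ∈ Finset.Icc 1 N, (𝐞 ((n' : ℝ) * ((m : ℝ) * (θ r - θ s))) : ℂ)‖ ≤
        geomBound (x / m) ((m : ℝ) * (θ r - θ s)) :=
      norm_sum_Icc_fourierChar_le_geomBound _ (Nat.floor_le (div_nonneg (by linarith) hm0.le))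
    calc ‖c r * conj (c s)‖ * ‖∑ n' ∈ Finset.Icc 1 N, (𝐞 ((n' : ℝ) * ((m : ℝ) * (θ r - θ s))) : ℂ)‖
        ≤ 1 * geomBound (x / m) ((m : ℝ) * (θ r - θ s)) :=
          mul_le_mul hcc hgeom (norm_nonneg _) zero_le_one
      _ = _ := one_mul _

end Literature.NumberTheory.Sieve

end
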